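import Summits.HodgeConjecture.CorCM.MumfordTateRankTypeIVThreefoldTimesCurvesRigid
import HarnessLib

/-!
# Multiplicities keep `Θ`-rigidity; every product of a simple type-IV(2,1) threefold with ANY elliptic curves (repetitions allowed) is `Θ`-rigid
# (Moonen–Zarhin 1999 §1, §3 (3.1): `Hg` only sees the set of simple factors; the projections of `Hg` are onto)

COR-CM (cell `pub-hodgecm2`, seat `b27` gen 51, count-neutral Mumford–Tate-rank ladder; theorems only, no definition, no named fact;
UNCONDITIONAL — nothing here uses or asserts HC_CM).  Notation `t(X) = dim MT(H¹X)`.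

`CorCM/MumfordTateRankTypeIVThreefoldTimesCurvesRigid` proves the rigidity of `T × ⨁E` for PAIRWISE NON-ISOGENOUS curves.  Repetitions are removed as in
`CorCM/MumfordTateRankBaseTimesMultiplicities`, now carrying RIGIDITY instead of the rank: a recurring factor is absorbed (`t((A' × B) × B) = t(A' × B)`,
so `hodgeLie_rigid_prod_of_rigid_of_mtRank_le` applies), a new factor joins the base, and rigidity travels along the book-keeping isogenies
(`hodgeLie_rigid_of_isIsogenous`).

* §1 **`hodgeLie_rigid_prod_biproduct_cls_of_rigid`** — for a surjective class map `cls : Fin (m+1) → Q`, ANY abelian varieties `R_q` and a base `A`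
  (`0 < dim A`): `H¹(A × ⨁_q R_q)` rigid ⟹ `H¹(A × ⨁_j R_{cls j})` rigid.
* §2 **`hodgeLie_rigid_of_isIsogenous_typeIV_threefold_prod_biproduct_anyCurves`** — `T` a simple abelian threefold with `dim_ℚ End⁰T = 2` and ANY
  elliptic curves `E₀, …, E_m`: `H¹X` is `Θ`-rigid for every `X ∼ T × ⨁E`; **`t(X) ≤ t(Z)` for every `Z ∼ X × Y`**.

## References
* [MoonenZarhin1999LowDim] B. Moonen, Yu. G. Zarhin, *Hodge classes on abelian varieties of low dimension*, Math. Ann. 315 (1999), §1, §3 (3.1), (3.4), (3.8)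
  [corpus: paper:arxiv-math_9901113 pp. 2, 6–7]. [cite: MoonenZarhin1999LowDim, §1 and §3 (3.1)]
* [Moonen1999MTNotes] B. Moonen, *Notes on Mumford–Tate groups* (1999), (1.7), (1.8), (1.13). [cite: Moonen1999MTNotes, (1.8) and (1.13)]
* [MumfordAV1970] D. Mumford, *Abelian Varieties* (1970), §19 Thm. 1, Cor. 2. [cite: MumfordAV1970, §19 Thm. 1]
-/

noncomputable section

open CategoryTheory CategoryTheory.Limits Module
open scoped BigOperators

namespace Summit.HodgeConjecture.CorCM

open Literature.AlgebraicGeometry.Motives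
open Literature.AlgebraicGeometry.Motives.AbelianVariety
open Literature.AlgebraicGeometry.Motives.HodgeStructure
open Literature.AlgebraicGeometry.HodgeTheory
open Literature.AlgebraicGeometry.ComplexMultiplication
open Literature.AlgebraicGeometry.Milne1999 (IsOfCMType isIsogeny_biproduct_map)

variable [HodgeTensorFacts.{0, 0}] {X T : AbelianVariety ℂ} {n : ℕ}

/-! ## §1 Multiplicities over a base keep rigidity -/

/-- **`H¹(A × ⨁_q R_q)` rigid ⟹ `H¹(A × ⨁_j R_{cls j})` rigid** for a surjective class map `cls : Fin (m + 1) → Q` (any `R_q`, `0 < dim A`): peel the index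
`0` — a recurring class gives an absorbed duplicate factor (`t` unchanged, `hodgeLie_rigid_prod_of_rigid_of_mtRank_le`), a class occurring once joins the
base; rigidity is moved along the isogenies by `hodgeLie_rigid_of_isIsogenous`. [cite: MoonenZarhin1999LowDim, §1 and §3 (3.1)] [cite: Moonen1999MTNotes, (1.8) and (1.13)] -/
theorem hodgeLie_rigid_prod_biproduct_cls_of_rigid : ∀ {m : ℕ} {Q : Type} [Fintype Q] [DecidableEq Q]
    (R : Q → AbelianVariety ℂ) (cls : Fin (m + 1) → Q) (_ : Function.Surjective cls)
    {A : AbelianVariety ℂ} {l l' : ℕ} (hP : IsSmoothProjective l (A.prod (⨁ fun j => R (cls j))).X) (hP' : IsSmoothProjective l' (A.prod (⨁ R)).X)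
    (_ : 0 < A.dim)
    (_ : haveI := BettiUniverse.finite hP' 1
      ∀ 𝔞 : Submodule ℚ (Module.End ℚ (bettiCohomology (A.prod (⨁ R)).X 1)),
        𝔞 ≤ (BettiUniverse.hodge exists_isReal_hodgeModel_holds hP' 1).hodgeLie →
        (∀ B ∈ 𝔞, ∀ B' ∈ 𝔞, B * B' - B' * B ∈ 𝔞) →
        (∃ Θ ∈ Submodule.span ℂ ((fun B : Module.End ℚ (bettiCohomology (A.prod (⨁ R)).X 1) => B.baseChange ℂ) ''
            (𝔞 : Set (Module.End ℚ (bettiCohomology (A.prod (⨁ R)).X 1)))),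
          ∀ p, ∀ x ∈ (BettiUniverse.hodge exists_isReal_hodgeModel_holds hP' 1).piece p (((1 : ℕ) : ℤ) - p),
            Θ x = ((2 * p - ((1 : ℕ) : ℤ) : ℤ) : ℂ) • x) →
        (BettiUniverse.hodge exists_isReal_hodgeModel_holds hP' 1).hodgeLie ≤ 𝔞),
    haveI := BettiUniverse.finite hP 1
    ∀ 𝔞 : Submodule ℚ (Module.End ℚ (bettiCohomology (A.prod (⨁ fun j => R (cls j))).X 1)),
      𝔞 ≤ (BettiUniverse.hodge exists_isReal_hodgeModel_holds hP 1).hodgeLie →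
      (∀ B ∈ 𝔞, ∀ B' ∈ 𝔞, B * B' - B' * B ∈ 𝔞) →
      (∃ Θ ∈ Submodule.span ℂ ((fun B : Module.End ℚ (bettiCohomology (A.prod (⨁ fun j => R (cls j))).X 1) => B.baseChange ℂ) ''
          (𝔞 : Set (Module.End ℚ (bettiCohomology (A.prod (⨁ fun j => R (cls j))).X 1)))),
        ∀ p, ∀ x ∈ (BettiUniverse.hodge exists_isReal_hodgeModel_holds hP 1).piece p (((1 : ℕ) : ℤ) - p),
          Θ x = ((2 * p - ((1 : ℕ) : ℤ) : ℤ) : ℂ) • x) →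
      (BettiUniverse.hodge exists_isReal_hodgeModel_holds hP 1).hodgeLie ≤ 𝔞
  | 0, Q, _, _, R, cls, hcls, A, l, l', hP, hP', _, hrig => by
    have hq : ∀ q, q = cls 0 := fun q => by
      obtain ⟨j, rfl⟩ := hcls q
      exact congrArg cls (Fin.ext (by have := j.2; omega))
    have h₁ : IsIsogenous (⨁ fun j => R (cls j)) (R (cls 0)) :=
      isIsogenous_biproduct_of_forall_eq (fun j => R (cls j)) 0 fun j => Fin.ext (by have := j.2; omega)
    have h₂ : IsIsogenous (⨁ R) (R (cls 0)) := isIsogenous_biproduct_of_forall_eq R (cls 0) hq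
    exact hodgeLie_rigid_of_isIsogenous hP' hP (((IsIsogenous.refl A).prod h₂).trans ((IsIsogenous.refl A).prod h₁).symm') hrig
  | m + 1, Q, _, _, R, cls, hcls, A, l, l', hP, hP', hA0, hrig => by
    classical
    obtain ⟨h, g, hhg, hgh⟩ := AndreRiemann.biproduct_succ_split (fun j => R (cls j))
    have hh : IsIsogeny h := isIsogeny_of_comp_eq_of_comp_eq (isIsogeny_id _) (isIsogeny_id _) hgh hhg
    have hsplit : IsIsogenous (⨁ fun j => R (cls j)) ((R (cls 0)).prod (⨁ fun j : Fin (m + 1) => R (cls j.succ))) := ⟨h, hh⟩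
    have hS : IsSmoothProjective (A.prod (⨁ fun j : Fin (m + 1) => R (cls j.succ))).dim (A.prod (⨁ fun j : Fin (m + 1) => R (cls j.succ))).X :=
      AbelianVariety.isSmoothProjective_holds
    haveI := BettiUniverse.finite hS 1
    haveI := BettiUniverse.finite hP 1
    by_cases hdup : ∃ j : Fin (m + 1), cls j.succ = cls 0
    · -- recurring class: the tail is rigid (induction), `R (cls 0)` is an absorbed duplicate
      obtain ⟨j, hj⟩ := hdup
      have hcls' : Function.Surjective (fun i : Fin (m + 1) => cls i.succ) := by
        intro q
        obtain ⟨i, hi⟩ := hcls q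
        refine Fin.cases ?_ (fun i' hi' => ⟨i', hi'⟩) i hi
        intro h0
        exact ⟨j, hj.trans h0⟩
      have hrigS := hodgeLie_rigid_prod_biproduct_cls_of_rigid R (fun i : Fin (m + 1) => cls i.succ) hcls' hS hP' hA0 hrig
      -- `t((tail) × R (cls 0)) = t(tail)`: duplicate factor
      have hW : IsSmoothProjective ((A.prod (⨁ fun i : Fin (m + 1) => R (cls i.succ))).prod (R (cls 0))).dim
          ((A.prod (⨁ fun i : Fin (m + 1) => R (cls i.succ))).prod (R (cls 0))).X := AbelianVariety.isSmoothProjective_holds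
      haveI := BettiUniverse.finite hW 1
      have herase := isIsogenous_biproduct_prod_erase (fun i : Fin (m + 1) => R (cls i.succ)) j
      have hbase : IsIsogenous (A.prod (⨁ fun i : Fin (m + 1) => R (cls i.succ)))
          ((A.prod (⨁ fun i : {i // i ≠ j} => R (cls i.1.succ))).prod (R (cls j.succ))) :=
        ((IsIsogenous.refl A).prod herase).trans
          (Literature.AlgebraicGeometry.HodgeTheory.isIsogenous_prod_assoc A _ (R (cls j.succ))).symm'
      have hWQ : IsIsogenous ((A.prod (⨁ fun i : Fin (m + 1) => R (cls i.succ))).prod (R (cls 0)))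
          (((A.prod (⨁ fun i : {i // i ≠ j} => R (cls i.1.succ))).prod (R (cls j.succ))).prod (R (cls j.succ))) := by
        rw [← hj]
        exact hbase.prod (IsIsogenous.refl _)
      have h0 : 0 < ((A.prod (⨁ fun i : {i // i ≠ j} => R (cls i.1.succ))).prod (R (cls j.succ))).dim := by
        rw [dim_prod, dim_prod]; omega
      have hdq := mtRank_hodge_one_eq_of_isIsogenous_prod_prod_self hW hS h0 hWQ hbase
      have hrigW := hodgeLie_rigid_prod_of_rigid_of_mtRank_le hS hW (by rw [dim_prod]; omega) hrigS hdq.le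
      have hPW : IsIsogenous (A.prod (⨁ fun j => R (cls j))) ((A.prod (⨁ fun i : Fin (m + 1) => R (cls i.succ))).prod (R (cls 0))) :=
        ((IsIsogenous.refl A).prod (hsplit.trans (isIsogenous_prod_comm _ _))).trans
          (Literature.AlgebraicGeometry.HodgeTheory.isIsogenous_prod_assoc A _ (R (cls 0))).symm'
      exact hodgeLie_rigid_of_isIsogenous hW hP hPW.symm' hrigW
    · -- the class of `0` occurs once: it joins the base
      push Not at hdup
      let Q' := {q // q ≠ cls 0}
      let cls' : Fin (m + 1) → Q' := fun i => ⟨cls i.succ, hdup i⟩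
      have hcls' : Function.Surjective cls' := by
        rintro ⟨q, hq⟩
        obtain ⟨i, hi⟩ := hcls q
        refine Fin.cases ?_ (fun i' hi' => ⟨i', Subtype.ext hi'⟩) i hi
        intro h0
        exact absurd h0.symm hq
      have hB : IsSmoothProjective ((A.prod (R (cls 0))).prod (⨁ fun i => (fun q : Q' => R q.1) (cls' i))).dim
          ((A.prod (R (cls 0))).prod (⨁ fun i => (fun q : Q' => R q.1) (cls' i))).X := AbelianVariety.isSmoothProjective_holds
      have hB' : IsSmoothProjective ((A.prod (R (cls 0))).prod (⨁ fun q : Q' => R q.1)).dim ((A.prod (R (cls 0))).prod (⨁ fun q : Q' => R q.1)).X :=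
        AbelianVariety.isSmoothProjective_holds
      -- the base `A × R (cls 0)` with all classes: isogenous to `A × ⨁ R`
      have hiso' : IsIsogenous (A.prod (⨁ R)) ((A.prod (R (cls 0))).prod (⨁ fun q : Q' => R q.1)) :=
        ((IsIsogenous.refl A).prod ((isIsogenous_biproduct_prod_erase R (cls 0)).trans (isIsogenous_prod_comm _ _))).trans
          (Literature.AlgebraicGeometry.HodgeTheory.isIsogenous_prod_assoc A (R (cls 0)) _).symm'
      have hrigB' := hodgeLie_rigid_of_isIsogenous hP' hB' hiso' hrig
      have hrigB := hodgeLie_rigid_prod_biproduct_cls_of_rigid (fun q : Q' => R q.1) cls' hcls' hB hB' (by rw [dim_prod]; omega) hrigB'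
      have hPB : IsIsogenous (A.prod (⨁ fun j => R (cls j))) ((A.prod (R (cls 0))).prod (⨁ fun i => (fun q : Q' => R q.1) (cls' i))) :=
        ((IsIsogenous.refl A).prod hsplit).trans (Literature.AlgebraicGeometry.HodgeTheory.isIsogenous_prod_assoc A (R (cls 0)) _).symm'
      exact hodgeLie_rigid_of_isIsogenous hB hP hPB.symm' hrigB

/-! ## §2 The type-IV threefold times ANY elliptic curves -/

/-- **`H¹X` is `Θ`-rigid for every `X ∼ T × E₀ × ⋯ × E_m` with ANY elliptic curves `E_j`** (repetitions allowed; `T` a simple abelian threefold with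
`dim_ℚ End⁰T = 2`): regroup the curves into isogeny classes (`cls`, representatives `R`), use the pairwise non-isogenous case
(`CorCM/MumfordTateRankTypeIVThreefoldTimesCurvesRigid`) for `T × ⨁_q R_q`, put the multiplicities back (§1), and move along `⨁E ∼ ⨁_j R_{cls j}`.
[cite: MoonenZarhin1999LowDim, §1 and §3 (3.1)] [cite: MumfordAV1970, §19 Thm. 1] -/
theorem hodgeLie_rigid_of_isIsogenous_typeIV_threefold_prod_biproduct_anyCurves {m : ℕ} {E : Fin (m + 1) → AbelianVariety ℂ}
    (hX : IsSmoothProjective n X.X) (hTs : T.IsSimple) (hT3 : T.dim = 3) (hTE : Module.finrank ℚ T.endAlgebra = 2)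
    (hE1 : ∀ j, (E j).dim = 1) (hXP : IsIsogenous X (T.prod (⨁ E))) :
    haveI := BettiUniverse.finite hX 1
    ∀ 𝔞 : Submodule ℚ (Module.End ℚ (bettiCohomology X.X 1)),
      𝔞 ≤ (BettiUniverse.hodge exists_isReal_hodgeModel_holds hX 1).hodgeLie →
      (∀ B ∈ 𝔞, ∀ B' ∈ 𝔞, B * B' - B' * B ∈ 𝔞) →
      (∃ Θ ∈ Submodule.span ℂ ((fun B : Module.End ℚ (bettiCohomology X.X 1) => B.baseChange ℂ) ''
          (𝔞 : Set (Module.End ℚ (bettiCohomology X.X 1)))),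
        ∀ p, ∀ x ∈ (BettiUniverse.hodge exists_isReal_hodgeModel_holds hX 1).piece p (((1 : ℕ) : ℤ) - p),
          Θ x = ((2 * p - ((1 : ℕ) : ℤ) : ℤ) : ℂ) • x) →
      (BettiUniverse.hodge exists_isReal_hodgeModel_holds hX 1).hodgeLie ≤ 𝔞 := by
  classical
  -- isogeny classes and representatives
  let r : Setoid (Fin (m + 1)) :=
    ⟨fun i j => IsIsogenous (E i) (E j), ⟨fun _ => IsIsogenous.refl _, fun h => h.symm', fun h h' => h.trans h'⟩⟩
  let cls : Fin (m + 1) → Quotient r := Quotient.mk r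
  let R : Quotient r → AbelianVariety ℂ := fun c => E c.out
  have hcls : Function.Surjective cls := fun c => ⟨c.out, c.out_eq⟩
  have hrel : ∀ j, IsIsogenous (E j) (R (cls j)) := fun j => by
    have h : r.r (cls j).out j := Quotient.exact (cls j).out_eq
    exact IsIsogenous.symm' h
  have hniso : ∀ c c', c ≠ c' → ¬ IsIsogenous (R c) (R c') := fun c c' hne h =>
    hne (by rw [← c.out_eq, ← c'.out_eq]; exact Quotient.sound h)
  have hmap : IsIsogenous (⨁ E) (⨁ fun j => R (cls j)) := by
    choose g hg using hrel
    exact ⟨biproduct.map g, isIsogeny_biproduct_map hg⟩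
  -- re-index the classes by `Fin (m' + 1)` and use the pairwise non-isogenous case
  have hcQ : Fintype.card (Quotient r) ≠ 0 := (Fintype.card_pos_iff.2 ⟨cls 0⟩).ne'
  obtain ⟨m', hm'⟩ := Nat.exists_eq_succ_of_ne_zero hcQ
  let eQ : Fin (m' + 1) ≃ Quotient r := (finCongr hm').symm.trans (Fintype.equivFin (Quotient r)).symm
  let RQ : Fin (m' + 1) → AbelianVariety ℂ := R ∘ eQ
  have hRQ : IsIsogenous (⨁ R) (⨁ RQ) := ⟨(biproduct.reindex eQ R).inv, isIsogeny_hom_of_iso (biproduct.reindex eQ R).symm⟩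
  have hY : IsSmoothProjective (T.prod (⨁ RQ)).dim (T.prod (⨁ RQ)).X := AbelianVariety.isSmoothProjective_holds
  have hY' : IsSmoothProjective (T.prod (⨁ R)).dim (T.prod (⨁ R)).X := AbelianVariety.isSmoothProjective_holds
  have hP : IsSmoothProjective (T.prod (⨁ fun j => R (cls j))).dim (T.prod (⨁ fun j => R (cls j))).X := AbelianVariety.isSmoothProjective_holds
  have hrigY := hodgeLie_rigid_of_isIsogenous_typeIV_threefold_prod_biproduct_curves hY hTs hT3 hTE (E := RQ) (fun i => hE1 _)
    (fun i i' hii' => hniso _ _ fun h => hii' (eQ.injective h)) (IsIsogenous.refl _)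
  have hrigY' := hodgeLie_rigid_of_isIsogenous hY hY' ((IsIsogenous.refl T).prod hRQ.symm') hrigY
  have hrigP := hodgeLie_rigid_prod_biproduct_cls_of_rigid R cls hcls hP hY' (by omega) hrigY'
  exact hodgeLie_rigid_of_isIsogenous hP hX (hXP.trans ((IsIsogenous.refl T).prod hmap)).symm' hrigP

/-- **`t(X) ≤ t(Z)` for every `Z ∼ X × Y`**, `X ∼ T × E₀ × ⋯ × E_m` with ANY elliptic curves and `Y` ARBITRARY (`T` a simple abelian threefold with
`dim_ℚ End⁰T = 2`). [cite: MoonenZarhin1999LowDim, §3 (3.1)] -/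
theorem mtRank_hodge_one_le_of_isIsogenous_typeIV_threefold_prod_biproduct_anyCurves_prod {m : ℕ} {E : Fin (m + 1) → AbelianVariety ℂ}
    {Z : AbelianVariety ℂ} {nZ : ℕ} (hZ : IsSmoothProjective nZ Z.X) (hX : IsSmoothProjective n X.X) (hTs : T.IsSimple) (hT3 : T.dim = 3)
    (hTE : Module.finrank ℚ T.endAlgebra = 2) (hE1 : ∀ j, (E j).dim = 1) (hXP : IsIsogenous X (T.prod (⨁ E))) {Y : AbelianVariety ℂ}
    (hZP : IsIsogenous Z (X.prod Y)) :
    haveI := BettiUniverse.finite hZ 1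
    haveI := BettiUniverse.finite hX 1
    (BettiUniverse.hodge exists_isReal_hodgeModel_holds hX 1).mtRank ≤ (BettiUniverse.hodge exists_isReal_hodgeModel_holds hZ 1).mtRank := by
  have hX0 : 0 < X.dim := by
    obtain ⟨f, hf⟩ := hXP
    rw [dim_eq_of_isIsogeny hf, dim_prod]; omega
  exact mtRank_hodge_one_le_of_isIsogenous_prod_of_rigid hZ hX hX0
    (hodgeLie_rigid_of_isIsogenous_typeIV_threefold_prod_biproduct_anyCurves hX hTs hT3 hTE hE1 hXP) hZP

end Summit.HodgeConjecture.CorCM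

end
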